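/-
Copyright (c) 2026 the pub-hodgecm-mathlib formalisation cell (harness21).  Prover seat hodgecm-mathlib-K2E3-p21 (g4), Track B «K2-LIT» ∕ h413
(`stmt-HodgeConjecture-24833`), line `K2_E3_EllipticInputs`, unit U12 §L, Richardson road for (LBGL-ge3) at `N = 3` (road owner K2E3-p11 (g4), deal (F-E)-A′
2026-09-04T05:21Z, «PLUS the 𝔭-slice form»): «THE 𝔭-SLICE FORMULA OF THE (2,1) PARABOLIC OF `𝔤𝔩₃(F)`».  2026-09-04.
-/
import Summits.HodgeConjecture.HodgeConjecture.Theorems.K2E3GL3ParabolicNilTwist          -- ★ p857618 (this seat): `lintegral_conj_leviBlock_eq` (the `𝔫_𝔭`-twist), `eval_charpoly_fin_two`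
import Summits.HodgeConjecture.HodgeConjecture.Theorems.K2E3GLnRichardsonMeasureRadon     -- ★ p857384 (this seat): `sFinite_haar_unipotentRadicalGL`
import Literature.MeasureTheory.Constructions.MvPolynomialZeroSetNull                    -- ★ `pi_zeroLocus_mvPolynomial_eq_zero` (zero sets of non-zero polynomials are null)
import Literature.NumberTheory.Automorphic.LocalFieldHaarBalls                            -- ★ `LocalFieldHaar.measure_singleton_zero`, `LocalFieldHaar.measurable_normAbs`
import HarnessLib

/-!
# K2_E3 road (h413), §L — Richardson road for (LBGL-ge3) at `N = 3`, brick (F-E)-A′2: the `𝔭`-slice formula of `𝔭 = 𝔭_{(2,1)} ⊂ 𝔤𝔩₃(F)`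
# `∫_K ∫_𝔭 f(Ad(k) P) dP dκ = C ∫_𝔪 |χ(m)|_F ∫_{K×U} f(Ad(k u) M(m)) d(κ⊗μ_U) dm`

Cell `pub/hodgecm-mathlib` (D-0151), Track B, seat K2E3-p21 (g4); road owner K2E3-p11 (g4) (05:21:40Z: «(F-E)-A′ … PLUS the 𝔭-slice form
`∫_K ∫_{r : Fin 7 → F} f(Ad k P(r)) d(pi dx) dκ = C ∫_{m : Fin 5 → F} |χ(m)| ∫_{K×U} f(Ad(k u) M(m)) d(κ⊗μU) d(pi dx)`, `M(m) = !![m 0, m 1, 0; m 2, m 3, 0; 0, 0, m 4]`,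
`χ(m) = (!![m 0, m 1; m 2, m 3]).charpoly.eval (m 4)`, the Fin 7 ↔ Fin 5 ⊕ Fin 2 split … inl ↦ (0,1,3,4,6), inr ↦ (2,5)»), §L lead K2E3-p12 (g4), dealer
K2E3-plan (g3).  `--supports stmt-HodgeConjecture-24833 --as helper`; THEOREMS ONLY (no definition ∕ instance ∕ notation ∕ named fact ∕ `sorry`); never imports
`Cruxes/…/Lines`.  COUNT-NEUTRAL ((LBGL-ge3) stays OPEN).

THE MATHEMATICS.  `𝔭 = 𝔪 ⊕ 𝔫_𝔭 ≅ F⁷` via `P(r) = [[r₀,r₁,r₂],[r₃,r₄,r₅],[0,0,r₆]] = M(m) + N(y)`, `m = (r₀,r₁,r₃,r₄,r₆)`, `y = (r₂,r₅)`.  By ★ A′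
(`lintegral_conj_leviBlock_eq`), for `χ(m) ≠ 0` and every `g`: `|χ(m)|_F ∫_U f(Ad(g u) M(m)) dμ_U = C_{A′} ∫_{F²} f(Ad(g)(M(m) + N(y))) dy`.  The exceptional set
`{χ = 0} ⊂ F⁵` is the zero locus of the non-zero polynomial `(X₄ − X₀)(X₄ − X₃) − X₁X₂`, hence `dm`-null (★ `pi_zeroLocus_mvPolynomial_eq_zero`; `dx` is atomless,
★ `LocalFieldHaar.measure_singleton_zero`) (§2); integrating in `m` and recombining `F⁵ × F² ≅ F⁷` (`measurePreserving_sumPiEquivProdPi`, `measurePreserving_piCongrLeft`,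
Tonelli; §3) gives the pointwise slice formula **`∫_{F⁷} f(Ad(g) P(r)) dr = C ∫_{F⁵} |χ(m)|_F ∫_U f(Ad(g u) M(m)) dμ_U dm`**, `C = C_{A′}⁻¹`, for EVERY `g ∈ GL₃(F)`
(§4), and, integrating over `K = GL₃(𝒪)` against any s-finite `κ` (Tonelli), the road owner's `K`-form (§4).
[HarishChandra1999AdmissibleDistributions, §7 Lemma 7.8]; [vanDijk1972, §2]; [Rogawski1990, §4.13 p. 70].

HONEST LABEL: HC_CM is proved only modulo the 7 printed citations (2 remaining named inputs: hLiu418 = stmt-HodgeConjecture-24832, h413 = stmt-HodgeConjecture-24833)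
until rung 0 closes; count-neutral helper.
-/

set_option autoImplicit false
set_option linter.dupNamespace false   -- `Summit.HodgeConjecture.HodgeConjecture.…` (D-0017 nested layout; lakefile exemption for Summits)

noncomputable section

open MeasureTheory MeasureTheory.Measure Filter Topology TopologicalSpace Polynomial Function
open scoped MatrixGroups NNReal ENNReal
open Literature.NumberTheory.Automorphic
open Literature.NumberTheory.GaloisRepresentations Literature.NumberTheory.GaloisRepresentations.IsNonarchimedeanLocalField
open Summit.HodgeConjecture.HodgeConjecture.Cruxes.H413.K2E3GLnRichardsonMeasureRadon
open Summit.HodgeConjecture.HodgeConjecture.Cruxes.H413.K2E3GL3ParabolicNilTwist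

namespace Summit.HodgeConjecture.HodgeConjecture.Cruxes.H413.K2E3GL3ParabolicSliceFubini

/-! ## §1  The index split `Fin 7 ≃ Fin 5 ⊕ Fin 2`, `P(r) = M(m) + N(y)`, and the polynomial `χ` -/

section Algebra

variable {R : Type*} [CommRing R]

/-- The slice index equivalence `Fin 5 ⊕ Fin 2 ≃ Fin 7`: `inl ↦ (0,1,3,4,6)` (the Levi coordinates `m`), `inr ↦ (2,5)` (the `𝔫_𝔭` coordinates `y`). [folklore] -/
theorem sliceIndexEquiv_exists : ∃ e : Fin 5 ⊕ Fin 2 ≃ Fin 7,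
    e (Sum.inl 0) = 0 ∧ e (Sum.inl 1) = 1 ∧ e (Sum.inl 2) = 3 ∧ e (Sum.inl 3) = 4 ∧ e (Sum.inl 4) = 6 ∧ e (Sum.inr 0) = 2 ∧ e (Sum.inr 1) = 5 := by
  let g : Fin 5 ⊕ Fin 2 → Fin 7 := Sum.elim ![0, 1, 3, 4, 6] ![2, 5]
  exact ⟨Equiv.ofBijective g (by decide), rfl, rfl, rfl, rfl, rfl, rfl, rfl⟩

/-- `M(m) + N(y) = P(m, y) = [[m₀,m₁,y₀],[m₂,m₃,y₁],[0,0,m₄]]`. [folklore] -/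
theorem leviBlock_add_nilBlock (m : Fin 5 → R) (y : Fin 2 → R) :
    (!![m 0, m 1, 0; m 2, m 3, 0; 0, 0, m 4] + !![0, 0, y 0; 0, 0, y 1; 0, 0, 0] : Matrix (Fin 3) (Fin 3) R) = !![m 0, m 1, y 0; m 2, m 3, y 1; 0, 0, m 4] := by
  ext i j
  fin_cases i <;> fin_cases j <;> simp

/-- `χ(m) = (X₄ − X₀)(X₄ − X₃) − X₁X₂` evaluated at `m`. [folklore] -/
theorem eval_slicePoly (m : Fin 5 → R) :
    MvPolynomial.eval (fun i => id (m i)) ((MvPolynomial.X 4 - MvPolynomial.X 0) * (MvPolynomial.X 4 - MvPolynomial.X 3) - MvPolynomial.X 1 * MvPolynomial.X 2 :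
      MvPolynomial (Fin 5) R) = (!![m 0, m 1; m 2, m 3] : Matrix (Fin 2) (Fin 2) R).charpoly.eval (m 4) := by
  rw [eval_charpoly_fin_two]
  simp only [map_sub, map_mul, MvPolynomial.eval_X, id]

/-- The slice polynomial `(X₄ − X₀)(X₄ − X₃) − X₁X₂` is not zero (value `1` at `e₄`). [folklore] -/
theorem slicePoly_ne_zero [Nontrivial R] :
    ((MvPolynomial.X 4 - MvPolynomial.X 0) * (MvPolynomial.X 4 - MvPolynomial.X 3) - MvPolynomial.X 1 * MvPolynomial.X 2 : MvPolynomial (Fin 5) R) ≠ 0 := by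
  intro h
  have h1 := congrArg (MvPolynomial.eval (fun i : Fin 5 => if i = 4 then (1 : R) else 0)) h
  simp only [map_sub, map_mul, MvPolynomial.eval_X, map_zero] at h1
  simp at h1

end Algebra

/-! ## §2  The exceptional set `{χ = 0} ⊂ 𝔪 ≅ F⁵` is `dm`-null -/

section Measure

variable {F : Type*} [Field F] [ValuativeRel F] [TopologicalSpace F] [IsNonarchimedeanLocalField F] [MeasurableSpace F] [BorelSpace F]

/-- **`{m : χ(m) = 0}` is null** for `dm = dx^{⊗5}`: it is the zero locus of the non-zero polynomial `(X₄ − X₀)(X₄ − X₃) − X₁X₂` and `dx` is atomless.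
[cite: HarishChandra1999AdmissibleDistributions, §7 Lemma 7.8] -/
theorem pi_setOf_eval_charpoly_eq_zero (dx : Measure F) [dx.IsAddHaarMeasure] :
    (Measure.pi fun _ : Fin 5 => dx) {m : Fin 5 → F | (!![m 0, m 1; m 2, m 3] : Matrix (Fin 2) (Fin 2) F).charpoly.eval (m 4) = 0} = 0 := by
  classical
  haveI : T2Space F := (isLocalField F).toT2Space
  haveI : LocallyCompactSpace F := (isLocalField F).toLocallyCompactSpace
  haveI : SecondCountableTopology F := secondCountableTopology_localField F
  haveI : IsTopologicalRing F := inferInstance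
  -- `dx` is atomless (translation invariance + ★ `measure_singleton_zero`)
  haveI : NullSingletonClass dx := ⟨fun x => by
    have h := measure_preimage_add dx (-x) ({0} : Set F)
    have hset : (fun y : F => -x + y) ⁻¹' ({0} : Set F) = {x} := by
      ext y
      simp only [Set.mem_preimage, Set.mem_singleton_iff, neg_add_eq_zero]
      exact eq_comm
    rw [hset] at h
    rw [h, LocalFieldHaar.measure_singleton_zero dx]⟩
  have hnull := Literature.MeasureTheory.Constructions.pi_zeroLocus_mvPolynomial_eq_zero (K := F) (X := F) (e := id) measurable_id
    Function.injective_id dx 5 _ (slicePoly_ne_zero (R := F))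
  simp_rw [eval_slicePoly] at hnull
  exact hnull

/-- **Almost every `m` has `χ(m) ≠ 0`.** [cite: HarishChandra1999AdmissibleDistributions, §7 Lemma 7.8] -/
theorem ae_eval_charpoly_ne_zero (dx : Measure F) [dx.IsAddHaarMeasure] :
    ∀ᵐ m : Fin 5 → F ∂(Measure.pi fun _ : Fin 5 => dx), (!![m 0, m 1; m 2, m 3] : Matrix (Fin 2) (Fin 2) F).charpoly.eval (m 4) ≠ 0 := by
  rw [ae_iff]
  simp only [not_not]
  exact pi_setOf_eval_charpoly_eq_zero dx

/-! ## §3  Tonelli on `𝔭 ≅ F⁷ = F⁵ × F²` in the slice coordinates -/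

omit [BorelSpace F] in
/-- **`∫_{F⁷} G(r) dr = ∫_{F⁵} ∫_{F²} G(m₀,m₁,y₀,m₂,m₃,y₁,m₄) dy dm`** for Borel `G ≥ 0` (the index split `Fin 7 ≃ Fin 5 ⊕ Fin 2`, `measurePreserving_piCongrLeft`,
`measurePreserving_sumPiEquivProdPi`, Tonelli). [folklore] -/
theorem lintegral_pi_fin_seven_eq (dx : Measure F) [dx.IsAddHaarMeasure] (G : (Fin 7 → F) → ℝ≥0∞) (hG : Measurable G) :
    ∫⁻ r : Fin 7 → F, G r ∂(Measure.pi fun _ : Fin 7 => dx) =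
      ∫⁻ m : Fin 5 → F, ∫⁻ y : Fin 2 → F, G ![m 0, m 1, y 0, m 2, m 3, y 1, m 4] ∂(Measure.pi fun _ : Fin 2 => dx) ∂(Measure.pi fun _ : Fin 5 => dx) := by
  classical
  haveI : T2Space F := (isLocalField F).toT2Space
  haveI : LocallyCompactSpace F := (isLocalField F).toLocallyCompactSpace
  haveI : SecondCountableTopology F := secondCountableTopology_localField F
  obtain ⟨e, he0, he1, he2, he3, he4, he5, he6⟩ := sliceIndexEquiv_exists
  set ε := MeasurableEquiv.piCongrLeft (fun _ : Fin 7 => F) e with hεdef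
  have hε : MeasurePreserving ε (Measure.pi fun _ : Fin 5 ⊕ Fin 2 => dx) (Measure.pi fun _ : Fin 7 => dx) := by
    rw [hεdef]; exact measurePreserving_piCongrLeft (fun _ : Fin 7 => dx) e
  set σ := MeasurableEquiv.sumPiEquivProdPi (fun _ : Fin 5 ⊕ Fin 2 => F) with hσdef
  have hσ : MeasurePreserving σ.symm ((Measure.pi fun _ : Fin 5 => dx).prod (Measure.pi fun _ : Fin 2 => dx)) (Measure.pi fun _ : Fin 5 ⊕ Fin 2 => dx) := by
    rw [hσdef]; exact measurePreserving_sumPiEquivProdPi_symm (fun _ : Fin 5 ⊕ Fin 2 => dx)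
  -- the recombined vector
  have hvec : ∀ (m : Fin 5 → F) (y : Fin 2 → F), ε (σ.symm (m, y)) = ![m 0, m 1, y 0, m 2, m 3, y 1, m 4] := fun m y => by
    have happ : ∀ i, ε (σ.symm (m, y)) (e i) = σ.symm (m, y) i := fun i => by
      rw [hεdef]; exact MeasurableEquiv.piCongrLeft_apply_apply (β := fun _ => F) e _ i
    have h0 : ε (σ.symm (m, y)) 0 = m 0 := by rw [← he0, happ]; rfl
    have h1 : ε (σ.symm (m, y)) 1 = m 1 := by rw [← he1, happ]; rfl
    have h2 : ε (σ.symm (m, y)) 3 = m 2 := by rw [← he2, happ]; rfl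
    have h3 : ε (σ.symm (m, y)) 4 = m 3 := by rw [← he3, happ]; rfl
    have h4 : ε (σ.symm (m, y)) 6 = m 4 := by rw [← he4, happ]; rfl
    have h5 : ε (σ.symm (m, y)) 2 = y 0 := by rw [← he5, happ]; rfl
    have h6 : ε (σ.symm (m, y)) 5 = y 1 := by rw [← he6, happ]; rfl
    funext j
    fin_cases j <;> simp [h0, h1, h2, h3, h4, h5, h6]
  rw [← hε.lintegral_comp_emb ε.measurableEmbedding, ← hσ.lintegral_comp_emb σ.symm.measurableEmbedding,
    lintegral_prod (fun p : (Fin 5 → F) × (Fin 2 → F) => G (ε (σ.symm p))) ((hG.comp (ε.measurable.comp σ.symm.measurable)).aemeasurable)]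
  refine lintegral_congr fun m => lintegral_congr fun y => ?_
  rw [hvec]

end Measure

/-! ## §4  The `𝔭`-slice formula: pointwise in `g ∈ GL₃(F)`, and integrated over `K = GL₃(𝒪)` -/

section Slice

variable {F : Type*} [Field F] [ValuativeRel F] [TopologicalSpace F] [IsNonarchimedeanLocalField F] [MeasurableSpace F] [BorelSpace F]
  [MeasurableSpace (GL (Fin 3) F)] [BorelSpace (GL (Fin 3) F)]
  [MeasurableSpace (Matrix (Fin 3) (Fin 3) F)] [BorelSpace (Matrix (Fin 3) (Fin 3) F)]

/-- **(F-E)-A′2 THE `𝔭`-SLICE FORMULA, POINTWISE IN `g`.**  `μ_U` Haar on `U = U_{(2,1)}`, `dx` additive Haar on `F`.  There is ONE `C ∈ (0, ∞)` with, for every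
`g ∈ GL₃(F)` and every Borel `f : 𝔤𝔩₃(F) → [0, ∞]`:
**`∫⁻_{r ∈ F⁷} f(g P(r) g⁻¹) dr = C ∫⁻_{m ∈ F⁵} |χ(m)|_F ∫⁻_U f((g u) M(m) (g u)⁻¹) dμ_U dm`**, `P(r) = [[r₀,r₁,r₂],[r₃,r₄,r₅],[0,0,r₆]]`,
`M(m) = [[m₀,m₁,0],[m₂,m₃,0],[0,0,m₄]]`, `χ(m) = χ_{[[m₀,m₁],[m₂,m₃]]}(m₄)` (★ A′ at a.e. `m`, §2, and Tonelli §3; `C = C_{A′}⁻¹`).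
[cite: HarishChandra1999AdmissibleDistributions, §7 Lemma 7.8] [cite: Rogawski1990, §4.13 p. 70] -/
theorem lintegral_pi_parabolic_conj_eq (μU : Measure ↥(unipotentRadicalGL F (![false, false, true] : Fin 3 → Bool))) [IsHaarMeasure μU]
    (dx : Measure F) [dx.IsAddHaarMeasure] :
    ∃ C : ℝ≥0∞, C ≠ 0 ∧ C ≠ ∞ ∧ ∀ (g : GL (Fin 3) F) (f : Matrix (Fin 3) (Fin 3) F → ℝ≥0∞), Measurable f →
      ∫⁻ r : Fin 7 → F, f ((g : Matrix (Fin 3) (Fin 3) F) * !![r 0, r 1, r 2; r 3, r 4, r 5; 0, 0, r 6] * ((g⁻¹ : GL (Fin 3) F) : Matrix (Fin 3) (Fin 3) F))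
          ∂(Measure.pi fun _ : Fin 7 => dx) =
        C * ∫⁻ m : Fin 5 → F, (normAbs F ((!![m 0, m 1; m 2, m 3] : Matrix (Fin 2) (Fin 2) F).charpoly.eval (m 4)) : ℝ≥0∞) *
          ∫⁻ u : ↥(unipotentRadicalGL F (![false, false, true] : Fin 3 → Bool)),
            f (((g * (u : GL (Fin 3) F) : GL (Fin 3) F) : Matrix (Fin 3) (Fin 3) F) * !![m 0, m 1, 0; m 2, m 3, 0; 0, 0, m 4] *
              (((g * (u : GL (Fin 3) F))⁻¹ : GL (Fin 3) F) : Matrix (Fin 3) (Fin 3) F)) ∂μU ∂(Measure.pi fun _ : Fin 5 => dx) := by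
  classical
  haveI : T2Space F := (isLocalField F).toT2Space
  haveI : LocallyCompactSpace F := (isLocalField F).toLocallyCompactSpace
  haveI : SecondCountableTopology F := secondCountableTopology_localField F
  haveI : IsTopologicalRing F := inferInstance
  obtain ⟨C, hC0, hCtop, hA⟩ := lintegral_conj_leviBlock_eq F μU dx
  refine ⟨C⁻¹, ENNReal.inv_ne_zero.2 hCtop, ENNReal.inv_ne_top.2 hC0, fun g f hf => ?_⟩
  -- `φ = f ∘ Ad(g)` is Borel
  have hφ : Measurable fun X : Matrix (Fin 3) (Fin 3) F => f ((g : Matrix (Fin 3) (Fin 3) F) * X * ((g⁻¹ : GL (Fin 3) F) : Matrix (Fin 3) (Fin 3) F)) :=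
    hf.comp ((continuous_const.mul continuous_id).mul continuous_const).measurable
  -- STEP 1 (★ A′ at `φ`): for `χ(m) ≠ 0`, `|χ(m)| ∫_U f(Ad(g u) M(m)) = C ∫_{F²} f(Ad(g) P(m, y)) dy`
  have hpt : ∀ m : Fin 5 → F, (!![m 0, m 1; m 2, m 3] : Matrix (Fin 2) (Fin 2) F).charpoly.eval (m 4) ≠ 0 →
      (normAbs F ((!![m 0, m 1; m 2, m 3] : Matrix (Fin 2) (Fin 2) F).charpoly.eval (m 4)) : ℝ≥0∞) *
        ∫⁻ u : ↥(unipotentRadicalGL F (![false, false, true] : Fin 3 → Bool)),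
          f (((g * (u : GL (Fin 3) F) : GL (Fin 3) F) : Matrix (Fin 3) (Fin 3) F) * !![m 0, m 1, 0; m 2, m 3, 0; 0, 0, m 4] *
            (((g * (u : GL (Fin 3) F))⁻¹ : GL (Fin 3) F) : Matrix (Fin 3) (Fin 3) F)) ∂μU =
      C * ∫⁻ y : Fin 2 → F, f ((g : Matrix (Fin 3) (Fin 3) F) * !![m 0, m 1, y 0; m 2, m 3, y 1; 0, 0, m 4] * ((g⁻¹ : GL (Fin 3) F) : Matrix (Fin 3) (Fin 3) F))
        ∂(Measure.pi fun _ : Fin 2 => dx) := fun m hχ => by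
    have h := hA m hχ _ hφ
    have hlhs : ∫⁻ u : ↥(unipotentRadicalGL F (![false, false, true] : Fin 3 → Bool)),
        f (((g * (u : GL (Fin 3) F) : GL (Fin 3) F) : Matrix (Fin 3) (Fin 3) F) * !![m 0, m 1, 0; m 2, m 3, 0; 0, 0, m 4] *
          (((g * (u : GL (Fin 3) F))⁻¹ : GL (Fin 3) F) : Matrix (Fin 3) (Fin 3) F)) ∂μU =
        ∫⁻ u : ↥(unipotentRadicalGL F (![false, false, true] : Fin 3 → Bool)),
          (fun X : Matrix (Fin 3) (Fin 3) F => f ((g : Matrix (Fin 3) (Fin 3) F) * X * ((g⁻¹ : GL (Fin 3) F) : Matrix (Fin 3) (Fin 3) F)))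
            (((u : GL (Fin 3) F) : Matrix (Fin 3) (Fin 3) F) * !![m 0, m 1, 0; m 2, m 3, 0; 0, 0, m 4] * ((((u : GL (Fin 3) F))⁻¹ : GL (Fin 3) F) : Matrix (Fin 3) (Fin 3) F))
            ∂μU := lintegral_congr fun u => by
      show f _ = f _
      rw [Units.val_mul, mul_inv_rev, Units.val_mul]
      simp only [Matrix.mul_assoc]
    rw [hlhs, h]
    simp_rw [leviBlock_add_nilBlock]
    have hx0 : (normAbs F ((!![m 0, m 1; m 2, m 3] : Matrix (Fin 2) (Fin 2) F).charpoly.eval (m 4)) : ℝ≥0∞) ≠ 0 :=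
      ENNReal.coe_ne_zero.2 ((map_ne_zero (normAbs F)).2 hχ)
    rw [ENNReal.coe_inv ((map_ne_zero (normAbs F)).2 hχ), ← mul_assoc, ← mul_assoc, mul_comm _ C, mul_assoc C,
      ENNReal.mul_inv_cancel hx0 ENNReal.coe_ne_top, mul_one]
  -- STEP 2: integrate in `m` (the identity holds for a.e. `m`), pull out `C`, and recombine `F⁵ × F² = F⁷`
  have hint := lintegral_congr_ae ((ae_eval_charpoly_ne_zero dx).mono fun m hm => hpt m hm)
  have hG : Measurable fun r : Fin 7 → F => f ((g : Matrix (Fin 3) (Fin 3) F) * !![r 0, r 1, r 2; r 3, r 4, r 5; 0, 0, r 6] * ((g⁻¹ : GL (Fin 3) F) : Matrix (Fin 3) (Fin 3) F)) := by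
    refine hf.comp ((continuous_const.mul (continuous_matrix fun i j => ?_)).mul continuous_const).measurable
    fin_cases i <;> fin_cases j <;> simp <;> fun_prop
  rw [hint, lintegral_const_mul' C _ hCtop, ← mul_assoc, ENNReal.inv_mul_cancel hC0 hCtop, one_mul, lintegral_pi_fin_seven_eq dx _ hG]
  refine lintegral_congr fun m => lintegral_congr fun y => ?_
  simp

/-- **(F-E)-A′2 THE `𝔭`-SLICE FORMULA, `K`-FORM (the road owner's statement).**  `κ` ANY s-finite measure on `K = GL₃(𝒪)` (e.g. Haar), `μ_U` Haar on `U`, `dx`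
additive Haar on `F`.  There is ONE `C ∈ (0, ∞)` with, for every Borel `f : 𝔤𝔩₃(F) → [0, ∞]`:
**`∫⁻_K ∫⁻_{r ∈ F⁷} f(k P(r) k⁻¹) dr dκ = C ∫⁻_{m ∈ F⁵} |χ(m)|_F ∫⁻_{K×U} f((k u) M(m) (k u)⁻¹) d(κ⊗μ_U) dm`** (the pointwise formula and Tonelli).
[cite: HarishChandra1999AdmissibleDistributions, §7 Lemma 7.8] [cite: Rogawski1990, §4.13 p. 70] -/
theorem lintegral_lintegral_pi_parabolic_conj_eq (κ : Measure ↥(glInt 3 F)) [SFinite κ]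
    (μU : Measure ↥(unipotentRadicalGL F (![false, false, true] : Fin 3 → Bool))) [IsHaarMeasure μU] (dx : Measure F) [dx.IsAddHaarMeasure] :
    ∃ C : ℝ≥0∞, C ≠ 0 ∧ C ≠ ∞ ∧ ∀ (f : Matrix (Fin 3) (Fin 3) F → ℝ≥0∞), Measurable f →
      ∫⁻ k : ↥(glInt 3 F), ∫⁻ r : Fin 7 → F,
          f (((k : GL (Fin 3) F) : Matrix (Fin 3) (Fin 3) F) * !![r 0, r 1, r 2; r 3, r 4, r 5; 0, 0, r 6] * ((((k : GL (Fin 3) F))⁻¹ : GL (Fin 3) F) : Matrix (Fin 3) (Fin 3) F))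
          ∂(Measure.pi fun _ : Fin 7 => dx) ∂κ =
        C * ∫⁻ m : Fin 5 → F, (normAbs F ((!![m 0, m 1; m 2, m 3] : Matrix (Fin 2) (Fin 2) F).charpoly.eval (m 4)) : ℝ≥0∞) *
          ∫⁻ q : ↥(glInt 3 F) × ↥(unipotentRadicalGL F (![false, false, true] : Fin 3 → Bool)),
            f ((((q.1 : GL (Fin 3) F) * (q.2 : GL (Fin 3) F) : GL (Fin 3) F) : Matrix (Fin 3) (Fin 3) F) * !![m 0, m 1, 0; m 2, m 3, 0; 0, 0, m 4] *
              ((((q.1 : GL (Fin 3) F) * (q.2 : GL (Fin 3) F))⁻¹ : GL (Fin 3) F) : Matrix (Fin 3) (Fin 3) F)) ∂(κ.prod μU) ∂(Measure.pi fun _ : Fin 5 => dx) := by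
  classical
  haveI : T2Space F := (isLocalField F).toT2Space
  haveI : LocallyCompactSpace F := (isLocalField F).toLocallyCompactSpace
  haveI : SecondCountableTopology F := secondCountableTopology_localField F
  haveI : IsTopologicalRing F := inferInstance
  haveI : SecondCountableTopology (Matrix (Fin 3) (Fin 3) F) := inferInstanceAs (SecondCountableTopology (Fin 3 → Fin 3 → F))
  haveI : SecondCountableTopology (Matrix (Fin 3) (Fin 3) F)ᵐᵒᵖ := MulOpposite.opHomeomorph.symm.secondCountableTopology
  haveI : SecondCountableTopology (GL (Fin 3) F) := Units.isEmbedding_embedProduct.secondCountableTopology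
  haveI : SecondCountableTopology ↥(glInt 3 F) := TopologicalSpace.Subtype.secondCountableTopology _
  haveI : SecondCountableTopology ↥(unipotentRadicalGL F (![false, false, true] : Fin 3 → Bool)) := TopologicalSpace.Subtype.secondCountableTopology _
  haveI : BorelSpace ↥(glInt 3 F) := Subtype.borelSpace _
  haveI : BorelSpace ↥(unipotentRadicalGL F (![false, false, true] : Fin 3 → Bool)) := Subtype.borelSpace _
  haveI : BorelSpace (↥(glInt 3 F) × ↥(unipotentRadicalGL F (![false, false, true] : Fin 3 → Bool))) := Prod.borelSpace
  haveI : BorelSpace (↥(glInt 3 F) × (Fin 5 → F)) := Prod.borelSpace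
  haveI : BorelSpace ((↥(glInt 3 F) × (Fin 5 → F)) × ↥(unipotentRadicalGL F (![false, false, true] : Fin 3 → Bool))) := Prod.borelSpace
  haveI : SFinite μU := sFinite_haar_unipotentRadicalGL μU
  haveI : SFinite dx := inferInstance
  obtain ⟨C, hC0, hCtop, hpt⟩ := lintegral_pi_parabolic_conj_eq μU dx
  refine ⟨C, hC0, hCtop, fun f hf => ?_⟩
  -- measurability of the triple integrand `((k, m), u) ↦ f((k u) M(m) (k u)⁻¹)`, of its `u`-integral, of the weight, and of the `K × U` integrand
  have h3 : Measurable fun p : (↥(glInt 3 F) × (Fin 5 → F)) × ↥(unipotentRadicalGL F (![false, false, true] : Fin 3 → Bool)) =>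
      f ((((p.1.1 : GL (Fin 3) F) * (p.2 : GL (Fin 3) F) : GL (Fin 3) F) : Matrix (Fin 3) (Fin 3) F) * !![p.1.2 0, p.1.2 1, 0; p.1.2 2, p.1.2 3, 0; 0, 0, p.1.2 4] *
        ((((p.1.1 : GL (Fin 3) F) * (p.2 : GL (Fin 3) F))⁻¹ : GL (Fin 3) F) : Matrix (Fin 3) (Fin 3) F)) := by
    have hc : Continuous fun p : (↥(glInt 3 F) × (Fin 5 → F)) × ↥(unipotentRadicalGL F (![false, false, true] : Fin 3 → Bool)) =>
        ((p.1.1 : GL (Fin 3) F) * (p.2 : GL (Fin 3) F) : GL (Fin 3) F) :=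
      (continuous_subtype_val.comp (continuous_fst.comp continuous_fst)).mul (continuous_subtype_val.comp continuous_snd)
    refine hf.comp (((Units.continuous_val.comp hc).mul (continuous_matrix fun i j => ?_)).mul (Units.continuous_coe_inv.comp hc)).measurable
    fin_cases i <;> fin_cases j <;> simp <;> fun_prop
  have h2 := h3.lintegral_prod_right' (ν := μU)
  have hw : Measurable fun p : ↥(glInt 3 F) × (Fin 5 → F) => (normAbs F ((!![p.2 0, p.2 1; p.2 2, p.2 3] : Matrix (Fin 2) (Fin 2) F).charpoly.eval (p.2 4)) : ℝ≥0∞) := by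
    refine (ENNReal.continuous_coe.measurable.comp LocalFieldHaar.measurable_normAbs).comp ?_
    have hχ : (fun p : ↥(glInt 3 F) × (Fin 5 → F) => ((!![p.2 0, p.2 1; p.2 2, p.2 3] : Matrix (Fin 2) (Fin 2) F).charpoly.eval (p.2 4))) =
        fun p => (p.2 4 - p.2 0) * (p.2 4 - p.2 3) - p.2 1 * p.2 2 := funext fun p => eval_charpoly_fin_two p.2
    rw [hχ]
    fun_prop
  have hq : ∀ m : Fin 5 → F, Measurable fun q : ↥(glInt 3 F) × ↥(unipotentRadicalGL F (![false, false, true] : Fin 3 → Bool)) =>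
      f ((((q.1 : GL (Fin 3) F) * (q.2 : GL (Fin 3) F) : GL (Fin 3) F) : Matrix (Fin 3) (Fin 3) F) * !![m 0, m 1, 0; m 2, m 3, 0; 0, 0, m 4] *
        ((((q.1 : GL (Fin 3) F) * (q.2 : GL (Fin 3) F))⁻¹ : GL (Fin 3) F) : Matrix (Fin 3) (Fin 3) F)) := fun m => by
    have hc : Continuous fun q : ↥(glInt 3 F) × ↥(unipotentRadicalGL F (![false, false, true] : Fin 3 → Bool)) =>
        ((q.1 : GL (Fin 3) F) * (q.2 : GL (Fin 3) F) : GL (Fin 3) F) :=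
      (continuous_subtype_val.comp continuous_fst).mul (continuous_subtype_val.comp continuous_snd)
    exact hf.comp (((Units.continuous_val.comp hc).mul continuous_const).mul (Units.continuous_coe_inv.comp hc)).measurable
  calc _ = ∫⁻ k : ↥(glInt 3 F), C * ∫⁻ m : Fin 5 → F, (normAbs F ((!![m 0, m 1; m 2, m 3] : Matrix (Fin 2) (Fin 2) F).charpoly.eval (m 4)) : ℝ≥0∞) *
          ∫⁻ u : ↥(unipotentRadicalGL F (![false, false, true] : Fin 3 → Bool)),
            f ((((k : GL (Fin 3) F) * (u : GL (Fin 3) F) : GL (Fin 3) F) : Matrix (Fin 3) (Fin 3) F) * !![m 0, m 1, 0; m 2, m 3, 0; 0, 0, m 4] *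
              ((((k : GL (Fin 3) F) * (u : GL (Fin 3) F))⁻¹ : GL (Fin 3) F) : Matrix (Fin 3) (Fin 3) F)) ∂μU ∂(Measure.pi fun _ : Fin 5 => dx) ∂κ :=
        lintegral_congr fun k => hpt (k : GL (Fin 3) F) f hf
    _ = C * ∫⁻ k : ↥(glInt 3 F), ∫⁻ m : Fin 5 → F, (normAbs F ((!![m 0, m 1; m 2, m 3] : Matrix (Fin 2) (Fin 2) F).charpoly.eval (m 4)) : ℝ≥0∞) *
          ∫⁻ u : ↥(unipotentRadicalGL F (![false, false, true] : Fin 3 → Bool)),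
            f ((((k : GL (Fin 3) F) * (u : GL (Fin 3) F) : GL (Fin 3) F) : Matrix (Fin 3) (Fin 3) F) * !![m 0, m 1, 0; m 2, m 3, 0; 0, 0, m 4] *
              ((((k : GL (Fin 3) F) * (u : GL (Fin 3) F))⁻¹ : GL (Fin 3) F) : Matrix (Fin 3) (Fin 3) F)) ∂μU ∂(Measure.pi fun _ : Fin 5 => dx) ∂κ :=
        lintegral_const_mul' C _ hCtop
    _ = C * ∫⁻ m : Fin 5 → F, ∫⁻ k : ↥(glInt 3 F), (normAbs F ((!![m 0, m 1; m 2, m 3] : Matrix (Fin 2) (Fin 2) F).charpoly.eval (m 4)) : ℝ≥0∞) *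
          ∫⁻ u : ↥(unipotentRadicalGL F (![false, false, true] : Fin 3 → Bool)),
            f ((((k : GL (Fin 3) F) * (u : GL (Fin 3) F) : GL (Fin 3) F) : Matrix (Fin 3) (Fin 3) F) * !![m 0, m 1, 0; m 2, m 3, 0; 0, 0, m 4] *
              ((((k : GL (Fin 3) F) * (u : GL (Fin 3) F))⁻¹ : GL (Fin 3) F) : Matrix (Fin 3) (Fin 3) F)) ∂μU ∂κ ∂(Measure.pi fun _ : Fin 5 => dx) := by
        rw [lintegral_lintegral_swap ((hw.mul h2).aemeasurable)]
    _ = C * ∫⁻ m : Fin 5 → F, (normAbs F ((!![m 0, m 1; m 2, m 3] : Matrix (Fin 2) (Fin 2) F).charpoly.eval (m 4)) : ℝ≥0∞) *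
          ∫⁻ k : ↥(glInt 3 F), ∫⁻ u : ↥(unipotentRadicalGL F (![false, false, true] : Fin 3 → Bool)),
            f ((((k : GL (Fin 3) F) * (u : GL (Fin 3) F) : GL (Fin 3) F) : Matrix (Fin 3) (Fin 3) F) * !![m 0, m 1, 0; m 2, m 3, 0; 0, 0, m 4] *
              ((((k : GL (Fin 3) F) * (u : GL (Fin 3) F))⁻¹ : GL (Fin 3) F) : Matrix (Fin 3) (Fin 3) F)) ∂μU ∂κ ∂(Measure.pi fun _ : Fin 5 => dx) := by
        congr 1
        refine lintegral_congr fun m => ?_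
        rw [lintegral_const_mul' _ _ ENNReal.coe_ne_top]
    _ = _ := by
        congr 1
        refine lintegral_congr fun m => ?_
        congr 1
        exact (lintegral_prod _ (hq m).aemeasurable).symm

end Slice

end Summit.HodgeConjecture.HodgeConjecture.Cruxes.H413.K2E3GL3ParabolicSliceFubini

end
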